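import Literature.Analysis.OperatorTheory.ModularGroupSubspace
import Literature.Analysis.OperatorTheory.ModularKernel
import Literature.Analysis.OperatorTheory.BorelFunctionalCalculusAtoms
import HarnessLib

/-!
# The KMS function of the modular group of a standard real subspace
# (Rieffel–van Daele, Proposition 3.7)

For a standard real subspace `𝒦` of a complex Hilbert space with modular group
`Δ^{it} = (2 − R)^{it} R^{−it}` (`modU`), Rieffel–van Daele (*A bounded operator approach to
Tomita–Takesaki theory*, Pacific J. Math. 69 (1977), Prop. 3.7) prove the KMS condition for pairs
of vectors of `𝒦`: "Let `ξ, η ∈ 𝒦` … we can take advantage of the fact that `ξ ∈ 𝒦` to extend `Δ^{it}ξ`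
analytically … `2ξ = 2Pξ = (R + TJ)ξ = R^{1/2}(R^{1/2} + (2 − R)^{1/2}J)ξ`, so that `ξ = R^{1/2}ζ`
if `2ζ = (R^{1/2} + (2 − R)^{1/2}J)ξ` … we can set `f(z) = ⟨(2 − R)^{iz} R^{−iz+1/2}ζ, η⟩` …
`2(2 − R)^{1/2}ζ = … = 2Jξ`".

We construct, for `ξ, η ∈ 𝒦`, a function `G = kmsFun` on `ℂ`, continuous and bounded on the closed
strip `0 ≤ Im z ≤ 1`, holomorphic inside, with the boundary values

`G(t) = ⟪ξ, Δ^{−it} η⟫`, `G(t + i) = ⟪η, Δ^{it} ξ⟫`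

(the form needed for the modular/KMS condition at `β = −1` of Tomita–Takesaki theory, Haag
(V.2.14); Rieffel–van Daele state the equivalent condition on `−1 ≤ Im z ≤ 0`). In place of the
operators `R^{iz}` of their Lemma 3.6 (which need the spectral theorem) we use the scalar integrals
`∫ λ e^{−izL(λ)} dμ(λ)` of `Literature.Analysis.OperatorTheory.ModularKernel` against the scalar
spectral measures of the four polarisation vectors `θ + i^k ζ` (with `ξ = R^{1/2}ζ`,
`η = R^{1/2}θ`), whose boundary values are identified through the Borel functional calculus
(`k(t, ·)(R) = R^{1/2} Δ^{−it} R^{1/2}` and, almost everywhere since `0, 2` are not eigenvalues,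
`k(t + i, ·)(R) = (2 − R)^{1/2} Δ^{−it} (2 − R)^{1/2}`) and the identities `R^{1/2}ζ = ξ`,
`(2 − R)^{1/2}ζ = Jξ`, `JΔ^{it} = Δ^{it}J`.

## Main definitions and results

* `sqrtR K`, `sqrtR' K` — `R^{1/2}`, `(2 − R)^{1/2}`; `zetaVec` — the vector `ζ` with `R^{1/2}ζ = ξ`,
  `(2 − R)^{1/2}ζ = Jξ` (`sqrtR_zetaVec`, `sqrtR'_zetaVec`).
* `kmsFun K hsep hdense ξ η` — the KMS function; `continuous_kmsFun`, `differentiableOn_kmsFun`,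
  `norm_kmsFun_le`, and the boundary values `kmsFun_ofReal`, `kmsFun_ofReal_add_I`.

## References
* M. A. Rieffel, A. van Daele, *A bounded operator approach to Tomita–Takesaki theory*, Pacific
  J. Math. 69 (1977) 187–221, Prop. 3.7 (and Def. 3.4, Lemma 3.6). [RieffelVandaele1977]
-/

noncomputable section

open Complex ContinuousLinearMap MeasureTheory Filter Set
open _root_.Topology
open scoped InnerProductSpace ComplexConjugate

set_option synthInstance.maxHeartbeats 200000

namespace Literature.Analysis.OperatorTheory

attribute [local instance] realIPS

variable {H : Type*} [NormedAddCommGroup H] [InnerProductSpace ℂ H] [CompleteSpace H]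

/-! ### A polarisation identity -/

omit [CompleteSpace H] in
/-- `4 ⟪x, X y⟫ = Σₖ iᵏ ⟪y + iᵏx, X (y + iᵏx)⟫`. [folklore] -/
theorem inner_polarization_four (X : H →L[ℂ] H) (x y : H) :
    4 * ⟪x, X y⟫_ℂ = ⟪y + x, X (y + x)⟫_ℂ + I * ⟪y + I • x, X (y + I • x)⟫_ℂ -
      ⟪y - x, X (y - x)⟫_ℂ - I * ⟪y - I • x, X (y - I • x)⟫_ℂ := by
  simp only [map_add, map_sub, map_smul, inner_add_left, inner_add_right, inner_sub_left,
    inner_sub_right, inner_smul_left, inner_smul_right, Complex.conj_I]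
  ring_nf
  rw [I_sq]
  ring

/-! ### Square roots of `R` and `2 − R` -/

section Sqrt

variable (K : Submodule ℝ H) [K.HasOrthogonalProjection]

/-- `R^{1/2}`. [cite: RieffelVandaele1977, Prop. 2.2 (2) and Prop. 3.7] -/
def sqrtR : H →L[ℂ] H := cfc Real.sqrt (modR K)

/-- `(2 − R)^{1/2}` (as a function of `R`). [cite: RieffelVandaele1977, Prop. 2.2 (2) and Prop. 3.7] -/
def sqrtR' : H →L[ℂ] H := cfc (fun l => Real.sqrt (2 - l)) (modR K)

/-- `R^{1/2}` is self-adjoint. [folklore] -/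
theorem sqrtR_isSelfAdjoint : IsSelfAdjoint (sqrtR K) := by unfold sqrtR; exact cfc_predicate _ _

/-- `(2 − R)^{1/2}` is self-adjoint. [folklore] -/
theorem sqrtR'_isSelfAdjoint : IsSelfAdjoint (sqrtR' K) := by unfold sqrtR'; exact cfc_predicate _ _

/-- `⟪R^{1/2} x, y⟫ = ⟪x, R^{1/2} y⟫`. [folklore] -/
theorem inner_sqrtR_left (x y : H) : ⟪sqrtR K x, y⟫_ℂ = ⟪x, sqrtR K y⟫_ℂ := by
  have h := ContinuousLinearMap.isSelfAdjoint_iff_isSymmetric.1 (sqrtR_isSelfAdjoint K)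
  simpa only [ContinuousLinearMap.coe_coe] using h x y

/-- `⟪(2−R)^{1/2} x, y⟫ = ⟪x, (2−R)^{1/2} y⟫`. [folklore] -/
theorem inner_sqrtR'_left (x y : H) : ⟪sqrtR' K x, y⟫_ℂ = ⟪x, sqrtR' K y⟫_ℂ := by
  have h := ContinuousLinearMap.isSelfAdjoint_iff_isSymmetric.1 (sqrtR'_isSelfAdjoint K)
  simpa only [ContinuousLinearMap.coe_coe] using h x y

/-- `T² = R(2 − R)` as a function of `R`. [cite: RieffelVandaele1977, Prop. 2.2 (2)] -/
theorem modTsq_eq_cfc : modTsq K = cfc (fun l : ℝ => l * (2 - l)) (modR K) := by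
  rw [modTsq, cfc_mul _ _ (modR K), cfc_id' ℝ (modR K) (modR_isSelfAdjoint K), cfc_two_sub_modR]

/-- **`T = R^{1/2}(2 − R)^{1/2}`** (Rieffel–van Daele Prop. 2.2 (2)). [cite: RieffelVandaele1977, Prop. 2.2 (2)] -/
theorem modT_eq_sqrtR_mul_sqrtR' : modT K = sqrtR K * sqrtR' K := by
  have hR := modR_isSelfAdjoint K
  rw [sqrtR, sqrtR', ← cfc_mul _ _ (modR K), modT, modTsq_eq_cfc,
    ← cfc_comp' Real.sqrt (fun l : ℝ => l * (2 - l)) (modR K) (Real.continuous_sqrt.continuousOn)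
      (by fun_prop) hR]
  refine cfc_congr fun l hl => ?_
  have h := spectrum_modR_subset K hl
  change Real.sqrt (l * (2 - l)) = Real.sqrt l * Real.sqrt (2 - l)
  rw [Real.sqrt_mul h.1]

/-- `T = (2 − R)^{1/2} R^{1/2}`. [cite: RieffelVandaele1977, Prop. 2.2 (2)] -/
theorem modT_eq_sqrtR'_mul_sqrtR : modT K = sqrtR' K * sqrtR K := by
  rw [modT_eq_sqrtR_mul_sqrtR', sqrtR, sqrtR']
  exact (cfc_commute_cfc _ _ _).eq

/-- `R^{1/2} R^{1/2} = R`. [folklore] -/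
theorem sqrtR_mul_sqrtR : sqrtR K * sqrtR K = modR K := by
  have hR := modR_isSelfAdjoint K
  rw [sqrtR, ← cfc_mul _ _ (modR K)]
  conv_rhs => rw [← cfc_id' ℝ (modR K) hR]
  exact cfc_congr fun l hl => Real.mul_self_sqrt (spectrum_modR_subset K hl).1

/-- `(2−R)^{1/2} (2−R)^{1/2} = 2 − R`. [folklore] -/
theorem sqrtR'_mul_sqrtR' : sqrtR' K * sqrtR' K = 2 - modR K := by
  rw [sqrtR', ← cfc_mul _ _ (modR K), ← cfc_two_sub_modR]
  exact cfc_congr fun l hl => Real.mul_self_sqrt (by linarith [(spectrum_modR_subset K hl).2])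

/-- `J R^{1/2} x = (2 − R)^{1/2} J x`. [cite: RieffelVandaele1977, §3 (p. 194)] -/
theorem modJ_sqrtR (hsep : ∀ x, x ∈ K → x ∈ mulI K → x = 0)
    (hdense : Dense ((K ⊔ mulI K : Submodule ℝ H) : Set H)) (x : H) :
    modJ K hsep hdense (sqrtR K x) = sqrtR' K (modJ K hsep hdense x) := by
  rw [sqrtR, modJ_cfc_modR' K hsep hdense Real.continuous_sqrt, sqrtR']

/-- `J (2 − R)^{1/2} x = R^{1/2} J x`. [cite: RieffelVandaele1977, §3 (p. 194)] -/
theorem modJ_sqrtR' (hsep : ∀ x, x ∈ K → x ∈ mulI K → x = 0)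
    (hdense : Dense ((K ⊔ mulI K : Submodule ℝ H) : Set H)) (x : H) :
    modJ K hsep hdense (sqrtR' K x) = sqrtR K (modJ K hsep hdense x) := by
  rw [sqrtR', modJ_cfc_modR' K hsep hdense (by fun_prop), sqrtR]
  congr 1
  exact cfc_congr fun l _ => by
    change Real.sqrt (2 - (2 - l)) = Real.sqrt l
    rw [sub_sub_cancel]

end Sqrt

/-! ### The vector `ζ` with `R^{1/2} ζ = ξ`, `(2 − R)^{1/2} ζ = J ξ` -/

section Zeta

variable (K : Submodule ℝ H) [K.HasOrthogonalProjection]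
variable (hsep : ∀ x, x ∈ K → x ∈ mulI K → x = 0)
variable (hdense : Dense ((K ⊔ mulI K : Submodule ℝ H) : Set H))

/-- The vector `ζ = ½ (R^{1/2} + (2 − R)^{1/2} J) ξ` of Rieffel–van Daele's proof of Prop. 3.7.
[cite: RieffelVandaele1977, Prop. 3.7 (proof)] -/
def zetaVec (ξ : H) : H := (2⁻¹ : ℂ) • (sqrtR K ξ + sqrtR' K (modJ K hsep hdense ξ))

/-- **`R^{1/2} ζ = ξ`** for `ξ ∈ 𝒦` ("`2ξ = 2Pξ = (R + TJ)ξ = R^{1/2}(R^{1/2} + (2−R)^{1/2}J)ξ`").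
[cite: RieffelVandaele1977, Prop. 3.7 (proof)] -/
theorem sqrtR_zetaVec {ξ : H} (hξ : ξ ∈ K) : sqrtR K (zetaVec K hsep hdense ξ) = ξ := by
  rw [zetaVec, map_smul, map_add, ← mul_apply_eq_comp, sqrtR_mul_sqrtR, ← mul_apply_eq_comp,
    ← modT_eq_sqrtR_mul_sqrtR', modT_modJ, modJ_modT, modR_apply, modB_apply,
    Submodule.starProjection_eq_self_iff.2 hξ]
  rw [show ξ + (mulI K).starProjection ξ + (ξ - (mulI K).starProjection ξ) = (2 : ℂ) • ξ by
    rw [two_smul]; abel, smul_smul]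
  norm_num

/-- **`(2 − R)^{1/2} ζ = J ξ`** for `ξ ∈ 𝒦` ("`2(2−R)^{1/2}ζ = (T + JR)ξ = … = 2JPξ = 2Jξ`").
[cite: RieffelVandaele1977, Prop. 3.7 (proof)] -/
theorem sqrtR'_zetaVec {ξ : H} (hξ : ξ ∈ K) :
    sqrtR' K (zetaVec K hsep hdense ξ) = modJ K hsep hdense ξ := by
  rw [zetaVec, map_smul, map_add, ← mul_apply_eq_comp, ← modT_eq_sqrtR'_mul_sqrtR,
    ← mul_apply_eq_comp, sqrtR'_mul_sqrtR', ← modJ_modR K hsep hdense, ← modJ_modB K hsep hdense,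
    ← map_add, modB_apply, modR_apply, Submodule.starProjection_eq_self_iff.2 hξ]
  rw [show ξ - (mulI K).starProjection ξ + (ξ + (mulI K).starProjection ξ) = ((2 : ℝ) : ℂ) • ξ by
    rw [Complex.ofReal_ofNat, two_smul]; abel, LinearIsometryEquiv.map_smulₛₗ, smul_smul,
    Complex.conj_ofReal]
  norm_num

end Zeta

/-! ### The functional calculus of `R` on the kernel -/

section Kernel

variable (K : Submodule ℝ H) [K.HasOrthogonalProjection]
variable (hsep : ∀ x, x ∈ K → x ∈ mulI K → x = 0)
variable (hdense : Dense ((K ⊔ mulI K : Submodule ℝ H) : Set H))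

/-- On the spectrum of `R` the clamped logarithm is `log(2 − λ) − log λ`. [folklore] -/
theorem modLog_of_mem_spectrum {l : ℝ} (hl : l ∈ spectrum ℝ (modR K)) :
    modLog l = Real.log (2 - l) - Real.log l := by
  rw [modLog, clamp02_of_mem (spectrum_modR_subset K hl)]

/-- On the spectrum, `e^{−itL(λ)} = f_{−t}(λ)`. [cite: RieffelVandaele1977, Def. 3.2] -/
theorem exp_neg_I_mul_modLog {l : ℝ} (hl : l ∈ spectrum ℝ (modR K)) (t : ℝ) :
    Complex.exp (-(I * (t : ℂ) * modLog l)) = modPhase (-t) l := by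
  rw [modPhase_apply, modLog_of_mem_spectrum K hl]
  congr 1
  push_cast
  ring

/-- The bounded continuous square root `√(clamp λ)`. [folklore] -/
theorem continuous_sqrt_clamp02 : Continuous fun l => Real.sqrt (clamp02 l) :=
  Real.continuous_sqrt.comp continuous_clamp02

/-- `R^{1/2}` through the Borel calculus. [folklore] -/
theorem sqrtR_eq_borelCFC :
    sqrtR K = borelCFC (modR K) (modR_isSelfAdjoint K) (fun l => (Real.sqrt (clamp02 l) : ℂ)) := by
  rw [borelCFC_ofReal_of_continuous (modR_isSelfAdjoint K) (continuous_sqrt_clamp02) (C := Real.sqrt 2)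
    (fun l => by
      rw [abs_of_nonneg (Real.sqrt_nonneg _)]
      exact Real.sqrt_le_sqrt (clamp02_mem l).2), sqrtR]
  exact cfc_congr fun l hl => by rw [clamp02_of_mem (spectrum_modR_subset K hl)]

/-- `(2 − R)^{1/2}` through the Borel calculus. [folklore] -/
theorem sqrtR'_eq_borelCFC :
    sqrtR' K = borelCFC (modR K) (modR_isSelfAdjoint K) (fun l => (Real.sqrt (2 - clamp02 l) : ℂ)) := by
  have hc : Continuous fun l => Real.sqrt (2 - clamp02 l) :=
    Real.continuous_sqrt.comp (continuous_const.sub continuous_clamp02)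
  have hb : ∀ l, |Real.sqrt (2 - clamp02 l)| ≤ Real.sqrt 2 := fun l => by
    rw [abs_of_nonneg (Real.sqrt_nonneg _)]
    exact Real.sqrt_le_sqrt (by linarith [(clamp02_mem l).1])
  rw [borelCFC_ofReal_of_continuous (modR_isSelfAdjoint K) (u := fun l => Real.sqrt (2 - clamp02 l))
    hc hb, sqrtR']
  exact cfc_congr fun l hl => by rw [clamp02_of_mem (spectrum_modR_subset K hl)]

/-- **`k(t, ·)(R) = R^{1/2} Δ^{−it} R^{1/2}`**. [cite: RieffelVandaele1977, Prop. 3.7 (proof)] -/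
theorem borelCFC_kfun_ofReal (t : ℝ) :
    borelCFC (modR K) (modR_isSelfAdjoint K) (kfun t) = sqrtR K * modU K (-t) * sqrtR K := by
  have hR := modR_isSelfAdjoint K
  have hsm : Measurable fun l => (Real.sqrt (clamp02 l) : ℂ) :=
    Complex.measurable_ofReal.comp continuous_sqrt_clamp02.measurable
  have hsb : ∀ l, ‖(Real.sqrt (clamp02 l) : ℂ)‖ ≤ Real.sqrt 2 := fun l => by
    rw [Complex.norm_real, Real.norm_eq_abs, abs_of_nonneg (Real.sqrt_nonneg _)]
    exact Real.sqrt_le_sqrt (clamp02_mem l).2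
  have hb2 : ∀ l, ‖((fun l => (Real.sqrt (clamp02 l) : ℂ)) * modPhase (-t)) l‖ ≤ Real.sqrt 2 * 1 :=
    fun l => by
      rw [Pi.mul_apply, norm_mul]
      exact mul_le_mul (hsb l) (norm_modPhase_le _ _) (norm_nonneg _) (Real.sqrt_nonneg _)
  have hb3 : ∀ l, ‖(((fun l => (Real.sqrt (clamp02 l) : ℂ)) * modPhase (-t)) *
      fun l => (Real.sqrt (clamp02 l) : ℂ)) l‖ ≤ Real.sqrt 2 * 1 * Real.sqrt 2 := fun l => by
    rw [Pi.mul_apply, norm_mul]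
    exact mul_le_mul (hb2 l) (hsb l) (norm_nonneg _) (by positivity)
  rw [sqrtR_eq_borelCFC, modU_def, ← borelCFC_mul hR hsm (measurable_modPhase (-t)) hsb
    (norm_modPhase_le (-t)), ← borelCFC_mul hR (hsm.mul (measurable_modPhase (-t))) hsm hb2 hsb]
  refine borelCFC_congr hR (measurable_kfun_right t) ((hsm.mul (measurable_modPhase (-t))).mul hsm)
    (norm_kfun_le t) hb3 ?_
  intro l hl
  have hl' := spectrum_modR_subset K hl
  simp only [Pi.mul_apply]
  rw [kfun_ofReal, exp_neg_I_mul_modLog K hl, clamp02_of_mem hl']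
  rw [show ((l : ℝ) : ℂ) = (Real.sqrt l : ℂ) * (Real.sqrt l : ℂ) by
    rw [← Complex.ofReal_mul, Real.mul_self_sqrt hl'.1]]
  ring

/-- The boundary kernel `m_t(λ) = (2 − λ) e^{−itL(λ)}` (clamped). [cite: RieffelVandaele1977, Prop. 3.7 (proof)] -/
def mfun (t l : ℝ) : ℂ := ((2 - clamp02 l : ℝ) : ℂ) * Complex.exp (-(I * (t : ℂ) * modLog l))

/-- `m_t` is measurable. [folklore] -/
theorem measurable_mfun (t : ℝ) : Measurable (mfun t) := by
  unfold mfun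
  exact (Complex.measurable_ofReal.comp (measurable_const.sub continuous_clamp02.measurable)).mul
    (Complex.measurable_exp.comp ((Complex.measurable_ofReal.comp measurable_modLog).const_mul _).neg)

/-- `|m_t| ≤ 2`. [folklore] -/
theorem norm_mfun_le (t l : ℝ) : ‖mfun t l‖ ≤ 2 := by
  rw [mfun, norm_mul, norm_exp_neg_I_mul, mul_one, Complex.norm_real, Real.norm_eq_abs,
    abs_of_nonneg (by linarith [(clamp02_mem l).2])]
  linarith [(clamp02_mem l).1]

/-- `k(t + i, λ) = m_t(λ)` for `0 < λ < 2`. [cite: RieffelVandaele1977, Prop. 3.7 (proof)] -/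
theorem kfun_add_I_eq_mfun (t : ℝ) {l : ℝ} (hl : l ∈ Ioo (0 : ℝ) 2) : kfun (t + I) l = mfun t l := by
  rw [kfun_ofReal_add_I_of_mem t hl, mfun, clamp02_of_mem ⟨hl.1.le, hl.2.le⟩]

/-- **`m_t(R) = (2 − R)^{1/2} Δ^{−it} (2 − R)^{1/2}`**. [cite: RieffelVandaele1977, Prop. 3.7 (proof)] -/
theorem borelCFC_mfun (t : ℝ) :
    borelCFC (modR K) (modR_isSelfAdjoint K) (mfun t) = sqrtR' K * modU K (-t) * sqrtR' K := by
  have hR := modR_isSelfAdjoint K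
  have hsm : Measurable fun l => (Real.sqrt (2 - clamp02 l) : ℂ) :=
    Complex.measurable_ofReal.comp (Real.continuous_sqrt.comp (continuous_const.sub continuous_clamp02)).measurable
  have hsb : ∀ l, ‖(Real.sqrt (2 - clamp02 l) : ℂ)‖ ≤ Real.sqrt 2 := fun l => by
    rw [Complex.norm_real, Real.norm_eq_abs, abs_of_nonneg (Real.sqrt_nonneg _)]
    exact Real.sqrt_le_sqrt (by linarith [(clamp02_mem l).1])
  have hb2 : ∀ l, ‖((fun l => (Real.sqrt (2 - clamp02 l) : ℂ)) * modPhase (-t)) l‖ ≤ Real.sqrt 2 * 1 :=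
    fun l => by
      rw [Pi.mul_apply, norm_mul]
      exact mul_le_mul (hsb l) (norm_modPhase_le _ _) (norm_nonneg _) (Real.sqrt_nonneg _)
  have hb3 : ∀ l, ‖(((fun l => (Real.sqrt (2 - clamp02 l) : ℂ)) * modPhase (-t)) *
      fun l => (Real.sqrt (2 - clamp02 l) : ℂ)) l‖ ≤ Real.sqrt 2 * 1 * Real.sqrt 2 := fun l => by
    rw [Pi.mul_apply, norm_mul]
    exact mul_le_mul (hb2 l) (hsb l) (norm_nonneg _) (by positivity)
  rw [sqrtR'_eq_borelCFC, modU_def, ← borelCFC_mul hR hsm (measurable_modPhase (-t)) hsb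
    (norm_modPhase_le (-t)), ← borelCFC_mul hR (hsm.mul (measurable_modPhase (-t))) hsm hb2 hsb]
  refine borelCFC_congr hR (measurable_mfun t) ((hsm.mul (measurable_modPhase (-t))).mul hsm)
    (norm_mfun_le t) hb3 ?_
  intro l hl
  have hl' := spectrum_modR_subset K hl
  simp only [Pi.mul_apply]
  rw [mfun, exp_neg_I_mul_modLog K hl, clamp02_of_mem hl']
  rw [show (((2 - l : ℝ)) : ℂ) = (Real.sqrt (2 - l) : ℂ) * (Real.sqrt (2 - l) : ℂ) by
    rw [← Complex.ofReal_mul, Real.mul_self_sqrt (by linarith [hl'.2])]]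
  ring

include hsep hdense in
/-- **`0 < λ < 2` almost everywhere** for every scalar spectral measure of `R` (`0` and `2` are not
eigenvalues: Rieffel–van Daele Prop. 2.2 (1), "the spectral measures for `R` and `2 − R` are both
concentrated on the open interval `(0, 2)`", p. 194). [cite: RieffelVandaele1977, §3 (p. 194)] -/
theorem ae_mem_Ioo (ψ : H) : ∀ᵐ l ∂(specMeasure (modR K) (modR_isSelfAdjoint K) ψ), l ∈ Ioo (0 : ℝ) 2 := by
  have hR := modR_isSelfAdjoint K
  have h0 : Function.Injective ((modR K) - ((0 : ℝ) : ℂ) • (1 : H →L[ℂ] H)) := by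
    simpa using modR_injective K hdense
  have h2 : Function.Injective ((modR K) - ((2 : ℝ) : ℂ) • (1 : H →L[ℂ] H)) := by
    have h := two_sub_modR_injective K hsep
    have h21 : ((2 : ℝ) : ℂ) • (1 : H →L[ℂ] H) = 2 := by
      rw [Complex.ofReal_ofNat, two_smul]; norm_num
    have heq : (modR K) - ((2 : ℝ) : ℂ) • (1 : H →L[ℂ] H) = -(2 - modR K) := by
      rw [h21, neg_sub]
    rw [heq]
    intro x y hxy
    apply h
    have := congrArg Neg.neg hxy
    simpa using this
  filter_upwards [ae_mem_spectrum hR ψ, ae_ne_of_injective hR 0 h0 ψ, ae_ne_of_injective hR 2 h2 ψ]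
    with l hl hl0 hl2
  have h := spectrum_modR_subset K hl
  exact ⟨lt_of_le_of_ne h.1 (Ne.symm hl0), lt_of_le_of_ne h.2 hl2⟩

include hsep hdense in
/-- `k(t + i, ·)(R) ψ = m_t(R) ψ` (a.e. equality of the functions). [cite: RieffelVandaele1977, Prop. 3.7 (proof)] -/
theorem borelCFC_kfun_add_I_apply (t : ℝ) (ψ : H) :
    borelCFC (modR K) (modR_isSelfAdjoint K) (kfun (t + I)) ψ = (sqrtR' K * modU K (-t) * sqrtR' K) ψ := by
  rw [← borelCFC_mfun]
  refine borelCFC_apply_eq_of_ae_eq (modR_isSelfAdjoint K) (measurable_kfun_right _) (measurable_mfun t)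
    (norm_kfun_le _) (norm_mfun_le t) ψ ?_
  filter_upwards [ae_mem_Ioo K hsep hdense ψ] with l hl
  exact kfun_add_I_eq_mfun t hl

end Kernel

/-! ### The KMS function -/

section KMS

variable (K : Submodule ℝ H) [K.HasOrthogonalProjection]
variable (hsep : ∀ x, x ∈ K → x ∈ mulI K → x = 0)
variable (hdense : Dense ((K ⊔ mulI K : Submodule ℝ H) : Set H))

/-- The scalar spectral measure of `v` for `R`. [cite: RieffelVandaele1977, Prop. 3.7 (proof)] -/
def specR (v : H) : Measure ℝ := specMeasure (modR K) (modR_isSelfAdjoint K) v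

/-- `specR` is finite. [folklore] -/
instance instIsFiniteMeasureSpecR (v : H) : IsFiniteMeasure (specR K v) := by
  unfold specR; infer_instance

/-- **The KMS function** of the pair `ξ, η` (polarisation of `z ↦ "⟪ζ, k(z,·)(R) θ⟫"` over the four
vectors `θ ± ζ`, `θ ± iζ`, `ξ = R^{1/2}ζ`, `η = R^{1/2}θ`). [cite: RieffelVandaele1977, Prop. 3.7] -/
def kmsFun (ξ η : H) (z : ℂ) : ℂ :=
  4⁻¹ * (kIntegral (specR K (zetaVec K hsep hdense η + zetaVec K hsep hdense ξ)) z +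
    I * kIntegral (specR K (zetaVec K hsep hdense η + I • zetaVec K hsep hdense ξ)) z -
    kIntegral (specR K (zetaVec K hsep hdense η - zetaVec K hsep hdense ξ)) z -
    I * kIntegral (specR K (zetaVec K hsep hdense η - I • zetaVec K hsep hdense ξ)) z)

/-- **The KMS function is continuous** (on all of `ℂ`). [cite: RieffelVandaele1977, Prop. 3.7] -/
theorem continuous_kmsFun (ξ η : H) : Continuous (kmsFun K hsep hdense ξ η) := by
  unfold kmsFun
  have := continuous_kIntegral
  fun_prop

/-- **The KMS function is holomorphic on the open strip `0 < Im z < 1`.** [cite: RieffelVandaele1977, Prop. 3.7] -/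
theorem differentiableOn_kmsFun (ξ η : H) : DifferentiableOn ℂ (kmsFun K hsep hdense ξ η) strip01 := by
  unfold kmsFun
  have h := fun v : H => differentiableOn_kIntegral (specR K v)
  refine DifferentiableOn.const_mul ?_ _
  refine ((((h _).add ((h _).const_mul _)).sub (h _)).sub ((h _).const_mul _))

/-- **The KMS function is bounded** (by `½ Σ ‖θ ± i^k ζ‖²`, uniformly on `ℂ`). [cite: RieffelVandaele1977, Prop. 3.7] -/
theorem norm_kmsFun_le (ξ η : H) (z : ℂ) :
    ‖kmsFun K hsep hdense ξ η z‖ ≤ 4⁻¹ * (2 * ‖zetaVec K hsep hdense η + zetaVec K hsep hdense ξ‖ ^ 2 +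
      2 * ‖zetaVec K hsep hdense η + I • zetaVec K hsep hdense ξ‖ ^ 2 +
      2 * ‖zetaVec K hsep hdense η - zetaVec K hsep hdense ξ‖ ^ 2 +
      2 * ‖zetaVec K hsep hdense η - I • zetaVec K hsep hdense ξ‖ ^ 2) := by
  have hb : ∀ v : H, ‖kIntegral (specR K v) z‖ ≤ 2 * ‖v‖ ^ 2 := fun v => by
    have := norm_kIntegral_le (specR K v) z
    rwa [specR, specMeasure_real_univ] at this
  unfold kmsFun
  rw [norm_mul, norm_inv, show ‖(4 : ℂ)‖ = 4 by simp]
  gcongr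
  calc ‖kIntegral (specR K (zetaVec K hsep hdense η + zetaVec K hsep hdense ξ)) z +
        I * kIntegral (specR K (zetaVec K hsep hdense η + I • zetaVec K hsep hdense ξ)) z -
        kIntegral (specR K (zetaVec K hsep hdense η - zetaVec K hsep hdense ξ)) z -
        I * kIntegral (specR K (zetaVec K hsep hdense η - I • zetaVec K hsep hdense ξ)) z‖
      ≤ ‖kIntegral (specR K (zetaVec K hsep hdense η + zetaVec K hsep hdense ξ)) z‖ +
        ‖I * kIntegral (specR K (zetaVec K hsep hdense η + I • zetaVec K hsep hdense ξ)) z‖ +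
        ‖kIntegral (specR K (zetaVec K hsep hdense η - zetaVec K hsep hdense ξ)) z‖ +
        ‖I * kIntegral (specR K (zetaVec K hsep hdense η - I • zetaVec K hsep hdense ξ)) z‖ :=
          norm_sub_le_of_le (norm_sub_le_of_le (norm_add_le _ _) le_rfl) le_rfl
    _ ≤ _ := by
        rw [norm_mul, norm_mul, Complex.norm_I, one_mul, one_mul]
        gcongr <;> exact hb _

/-- The integral of `k(z, ·)` against `μ_v` is the diagonal matrix element `⟪v, k(z,·)(R) v⟫`.
[cite: RieffelVandaele1977, Prop. 3.7 (proof)] -/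
theorem kIntegral_specR_eq_inner (v : H) (z : ℂ) :
    kIntegral (specR K v) z = ⟪v, borelCFC (modR K) (modR_isSelfAdjoint K) (kfun z) v⟫_ℂ := by
  rw [kIntegral, specR, inner_borelCFC_eq_integral (modR_isSelfAdjoint K) (measurable_kfun_right z)
    (norm_kfun_le z)]

/-- The polarised sum is `4 ⟪ζ, k(z,·)(R) θ⟫`. [cite: RieffelVandaele1977, Prop. 3.7 (proof)] -/
theorem kmsFun_eq_inner (ξ η : H) (z : ℂ) :
    kmsFun K hsep hdense ξ η z =
      ⟪zetaVec K hsep hdense ξ, borelCFC (modR K) (modR_isSelfAdjoint K) (kfun z) (zetaVec K hsep hdense η)⟫_ℂ := by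
  unfold kmsFun
  simp only [kIntegral_specR_eq_inner]
  rw [← inner_polarization_four]
  ring

/-- **Boundary values on the real line**: `G(t) = ⟪ξ, Δ^{−it} η⟫` for `ξ, η ∈ 𝒦`.
[cite: RieffelVandaele1977, Prop. 3.7] -/
theorem kmsFun_ofReal {ξ η : H} (hξ : ξ ∈ K) (hη : η ∈ K) (t : ℝ) :
    kmsFun K hsep hdense ξ η t = ⟪ξ, modU K (-t) η⟫_ℂ := by
  rw [kmsFun_eq_inner, borelCFC_kfun_ofReal, mul_apply_eq_comp, mul_apply_eq_comp, ← inner_sqrtR_left,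
    sqrtR_zetaVec K hsep hdense hξ, sqrtR_zetaVec K hsep hdense hη]

/-- **Boundary values on the line `Im z = 1`**: `G(t + i) = ⟪η, Δ^{it} ξ⟫` for `ξ, η ∈ 𝒦`.
[cite: RieffelVandaele1977, Prop. 3.7] -/
theorem kmsFun_ofReal_add_I {ξ η : H} (hξ : ξ ∈ K) (hη : η ∈ K) (t : ℝ) :
    kmsFun K hsep hdense ξ η (t + I) = ⟪η, modU K t ξ⟫_ℂ := by
  -- polarise, replace `k(t+i,·)(R)` by `(2−R)^{1/2} Δ^{−it} (2−R)^{1/2}` on each vector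
  have key : ∀ v : H, ⟪v, borelCFC (modR K) (modR_isSelfAdjoint K) (kfun (t + I)) v⟫_ℂ =
      ⟪v, (sqrtR' K * modU K (-t) * sqrtR' K) v⟫_ℂ := fun v => by
    rw [borelCFC_kfun_add_I_apply K hsep hdense t v]
  have h1 : kmsFun K hsep hdense ξ η (t + I) =
      ⟪zetaVec K hsep hdense ξ, (sqrtR' K * modU K (-t) * sqrtR' K) (zetaVec K hsep hdense η)⟫_ℂ := by
    unfold kmsFun
    simp only [kIntegral_specR_eq_inner, key]
    rw [← inner_polarization_four]
    ring
  rw [h1, mul_apply_eq_comp, mul_apply_eq_comp, ← inner_sqrtR'_left, sqrtR'_zetaVec K hsep hdense hξ,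
    sqrtR'_zetaVec K hsep hdense hη, ← modJ_modU K hsep hdense, inner_modJ_modJ,
    ← ContinuousLinearMap.adjoint_inner_right, ← ContinuousLinearMap.star_eq_adjoint, star_modU, neg_neg]

end KMS

end Literature.Analysis.OperatorTheory
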